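import Summits.QuantumFields.BalabanUV.Beta.GAN24.DressedLegEnvelope
import Summits.QuantumFields.BalabanUV.Beta.GAN24.Push4LegTelescopeComb
import Summits.QuantumFields.BalabanUV.Beta.HessKerCoDressedBmWall
import Summits.QuantumFields.BalabanUV.Beta.GAN24.ContactOneGaugeCellAlgebra

/-!
# `BalabanUV.Beta.GAN24.DressedSlotLegSplit` — binder row G-an2-4 ∕ (CONV-C), W-slot, the (α-0) parity re-cut, located crux (Q-L-k₀)
# (RULING R-gan24p1-g36-1 (4)(A): `T^E = Π^ρ_bm T^B + dz Ψ`; OWNER `b2b-balaban-gan24-p1` gen 37, part 5 — INPUT (E-c) OF THE (H1♮) WINDOW, TYPED):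
# **THE CARRIER's COMPOSITE SLOT LEGS ARE DRESSED LEGS `r + d_zφ` WITH leaf-12's ENVELOPES** — the `hE`, `hr`, `hr′`, `hφ` binders of leaf-01 g74's k₀-fold window
# `LegPushDressedBoundBlockL1.locStencil₂_legChain_bsumPow_of_dressed_envelopes_of_blockL1`, for the socket's own dressed kernels.

NOT IN PRINT; OUR BOOKKEEPING ([folklore] re-indexing BY NAME over leaf-03 g41∕leaf-01 g43's decomposition `legAct_legChain_respStepBm`, leaf-01 g57's `DressedLegEnvelope`
(point datum, `Psi_single_envelope`, `bmGaugeAt_respStep_envelope`), leaf-12's `RespStepDecay.exists_respStep_decay_and_grad`, asym1's `unitK_coDressKBmAt`, leaf-03's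
`legChain_colH_coDress`; 0 `def`, 0 cited facts, 0 `def … : Prop`, 0 sorry).  HONEST FRAMING (cell contract, verbatim): «discharging `BetaPertH` makes Bałaban's UV stability
UNCONDITIONAL — a real constructive-QFT result; it is NOT the continuum limit and NOT the Clay problem.»  HONEST DEPENDENCY (verbatim): «continuum YM on T⁴ ⇐ BetaPertH ∧
nine spine estimates (0/9 proved); BetaPertH ⇐ (D1) ∧ (D4) ∧ CAP+tail; G-an2-4 gates asym, D1 and NE2/3/4.»

WHAT (`K♮ᴱ_j := unitK (sfStep Lc j) (smStep d Lc j) (coDressKBmAt ρ Lc (KInvStep Lc j))`, in-block root `ρ = toSite rr`, point datum `1_{(μ,y)}`):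
* §1 (generic `d`) **`legChain_dressed_colH_eq`** — THE IDENTIFICATION `hE`, pointwise and as a function:
  `Push4Iter.legChain (j ↦ colH K♮ᴱ_j Lc) m k = fun μ y κ v ↦ respStep (Lc^m) (Lc^{m+k+1}) μ y κ v + (φ μ y (v + e_κ) − φ μ y v)` with the GAUGE POTENTIAL
  `φ μ y := Psi ρ Lc m k 1_{(μ,y)} − bmGaugeAt ρ (legAct (respStep (Lc^m) (Lc^{m+k+1})) 1_{(μ,y)}) Lc` (a lambda, no `def`): the dressed composite column IS
  the UNDRESSED composite response (ONE `respStep` by the semigroup) plus the unit gradient of (the accumulated inter-block gauge `Ψ` minus the block-mean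
  axial gauge of the undressed response) — `legChain_colH_coDress` ⨾ `legAct_single` ⨾ `legAct_legChain_respStepBm` ⨾ `axProjBmAt = · − grad (bmGaugeAt ·)`.
* §2 (`d = 3`, `2 ≤ Lc`) **`exists_dressed_slotLeg_envelopes`** — ONE rate `κ₀ > 0` (leaf-12's) and constants `C, C′, Cφ ≥ 0` with, for every in-block root and
  ALL `m k`, at the SOURCE blocking `L = Lc^{k+1}` (`E_y(v) = e^{−κ₀‖quo L v − y‖∞}`): sup `|respStep … μ y κ v| ≤ C·(Lc^{5(k+1)})⁻¹·E_y(v)` (= `a`, `(L^{d+2})⁻¹`), unit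
  gradient `|respStep … (v + e_i) − respStep … v| ≤ C′·(Lc^{6(k+1)})⁻¹·E_y(v)` (= `a′`, `(L^{d+3})⁻¹` — THE FOURTH GRADIENT-TYPE LEG of the power ledger), potential
  `|φ μ y v| ≤ Cφ·(Lc^{4(k+1)})⁻¹·E_y(v)` (= `a_φ`, `(L^{d+1})⁻¹`; `Cφ = 16C + 8·Lc·C`).
So, BY NAME, with MY part 4 (`CarrierKernelLegBlockL1.exists_kChain_dressed_blockMass`: the kernel leg's block mass `K″·(k+1)·(Lc^{k+1})⁻¹`) EVERY input of leaf-01's window is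
typed for the socket's objects; the window's `C`-coefficient reads `θ(k₀) = L^{3(d+1)}·K″k₀L^{−1}·a′²·c(δ) = c′(δ)·k₀·L^{3d+2−2d−6} = c′(δ)·k₀·Lc^{−k₀}` at `d = 3` (RULING (2):
the DOUBLE FIRST-MOMENT FREEZING's `L^{d−4}`), `< 1` for `k₀` large by MY `LegWindowArithmetic` — what remains is (E-d), the socket call itself (`LegRowsOnRuledClass` ∕ leaf-03 g68's
`LegRowsOfWindows`), pure assembly + that arithmetic.  Asserts NOTHING about Bałaban's tables beyond leaf-12's (N1)∕(N1′) letters (✓ in the tree); NOT (H1♮); NOTHING of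
(Q-L) ∕ (C)sym discharged; NEVER «G-an2-4 closed» as (CONV-C); NOT D1, NOT `BetaPertH`, NOT continuum, NOT Clay; not in print.
Unit `b2b-balaban-gan24-p1` (BINDER row G-an2-4 OWNER; CRUX PROVER on C-R8° CT-ROUTE), gen 37, 2026-08-23.
-/

noncomputable section

open Finset
open scoped BigOperators
open Literature.MathematicalPhysics.QuantumFieldTheory
open Literature.MathematicalPhysics.QuantumFieldTheory.LatticeForm (quo)
open Literature.MathematicalPhysics.QuantumFieldTheory.Balaban1983to89
open Literature.MathematicalPhysics.QuantumFieldTheory.Balaban1983to89.Beta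
open B4ContourShift (supNorm)
open OneStepKernelFamily (KInvStep colH)
open AffineAveraging (Form0 Form1 Site box toSite dz)
open B6BondElimination (unitVec)
open AveragingContours (blk grad grad_eq_dz)
open BalabanCompositeJets (respStep)
open Summit.QuantumFields.BalabanUV.Beta.HessKerDressedUnits (unitK)
open Summit.QuantumFields.BalabanUV.Beta.HessKerCoDressedBmWall (unitK_coDressKBmAt)
open Summit.QuantumFields.BalabanUV.Beta.AxialDressingRooted (coDressKBmAt)
open Summit.QuantumFields.BalabanUV.Beta.AxialProjectorBlockMean (bmGaugeAt axProjBmAt)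
open Summit.QuantumFields.BalabanUV.Beta.GAN24.CombesThomas (sfStep smStep sfStep_ne_zero smStep_ne_zero KStepUnit)
open Summit.QuantumFields.BalabanUV.Beta.GAN24.Push4Iter (LegFam legChain)
open Summit.QuantumFields.BalabanUV.Beta.GAN24.Push4LegTelescopeComb (legChain_colH_coDress)
open Summit.QuantumFields.BalabanUV.Beta.GAN24.RespStepBmDecompLegs (legAct)
open Summit.QuantumFields.BalabanUV.Beta.GAN24.RespStepBmDecompExact (respStepBmSeq)
open Summit.QuantumFields.BalabanUV.Beta.GAN24.RespStepBmDecompPsi (Psi legAct_legChain_respStepBm)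
open Summit.QuantumFields.BalabanUV.Beta.GAN24.RespStepDecay (exists_respStep_decay_and_grad)
open Summit.QuantumFields.BalabanUV.Beta.GAN24.UndressedResponseUnits (inv_cast_pow_pow)
open Summit.QuantumFields.BalabanUV.Beta.GAN24.DressedLegEnvelope (bmGaugeAt_respStep_envelope Psi_single_envelope blk_pow_blk_pow legAct_single summable_single_and_le)
open Summit.QuantumFields.BalabanUV.Beta.GAN24.ContactOneGaugeCellAlgebra (affine_unitVec_eq)

namespace Summit.QuantumFields.BalabanUV.Beta.GAN24.DressedSlotLegSplit

/-! ## §1 The identification `hE` (generic `d`) -/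

section Identity

variable {d : ℕ} {Lc : ℕ} [NeZero Lc]

/-- [folklore] The socket's dressed kernels are the co-dressed unit kernels: `K♮ᴱ_j = Πᵀ_bm K̃_j Π_bm` (asym1's `unitK_coDressKBmAt`; `KStepUnit` is `rfl`), hence their
`ℋ`-column families are leaf-01 g43's. -/
theorem colH_dressed_seq (ρ : Fin (d + 1) → ℤ) :
    (fun j => colH (unitK (sfStep Lc j) (smStep d Lc j) (coDressKBmAt ρ Lc (KInvStep (d := d) Lc j))) Lc)
      = fun j => colH (coDressKBmAt ρ Lc (KStepUnit (d := d) Lc j)) Lc := by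
  funext j
  rw [unitK_coDressKBmAt ρ Lc (sfStep_ne_zero j) (smStep_ne_zero j)]

/-- NOT IN PRINT; OUR BOOKKEEPING.  **THE IDENTIFICATION `hE`: THE CARRIER's COMPOSITE SLOT LEGS ARE THE UNDRESSED COMPOSITE RESPONSE PLUS A UNIT GRADIENT**
(as displayed in the module docstring; in-block root; every `m k`; `e_κ = B6BondElimination.unitVec κ`, the window's spelling). -/
theorem legChain_dressed_colH_eq {rr : Fin (d + 1) → ℕ} (hrr : rr ∈ box (d + 1) Lc) (m k : ℕ) :
    legChain (fun j => colH (unitK (sfStep Lc j) (smStep d Lc j) (coDressKBmAt (toSite rr) Lc (KInvStep (d := d) Lc j))) Lc) m k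
      = fun μ y κ v =>
          respStep (d := d) (Lc ^ m) (Lc ^ (m + k + 1)) μ y κ v
            + ((fun (μ : Fin (d + 1)) (y v : Site (d + 1)) =>
                  Psi (toSite rr) Lc m k (fun μ' y' => if μ' = μ then (if y' = y then (1 : ℝ) else 0) else 0) v
                    - bmGaugeAt (toSite rr) (legAct (respStep (d := d) (Lc ^ m) (Lc ^ (m + k + 1)))
                        (fun μ' y' => if μ' = μ then (if y' = y then (1 : ℝ) else 0) else 0)) Lc v) μ y (v + unitVec κ)
              - (fun (μ : Fin (d + 1)) (y v : Site (d + 1)) =>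
                  Psi (toSite rr) Lc m k (fun μ' y' => if μ' = μ then (if y' = y then (1 : ℝ) else 0) else 0) v
                    - bmGaugeAt (toSite rr) (legAct (respStep (d := d) (Lc ^ m) (Lc ^ (m + k + 1)))
                        (fun μ' y' => if μ' = μ then (if y' = y then (1 : ℝ) else 0) else 0)) Lc v) μ y v) := by
  funext μ y κ v
  rw [colH_dressed_seq, legChain_colH_coDress,
    ← legAct_single (legChain (respStepBmSeq (d := d) (toSite rr) Lc) m k) μ y κ v,
    legAct_legChain_respStepBm hrr m k (summable_single_and_le (d := d) μ y).1]
  simp only [Pi.add_apply, Pi.sub_apply, axProjBmAt, grad, dz, legAct_single, affine_unitVec_eq]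
  ring

end Identity

/-! ## §2 The envelopes (`d = 3`) -/

section Three

variable {Lc : ℕ} [NeZero Lc]

/-- NOT IN PRINT; OUR BOOKKEEPING.  **THE ENVELOPES OF THE THREE PIECES AT THE SOURCE BLOCKING `L = Lc^{k+1}`** (as displayed in the module docstring): leaf-12's
(N1)∕(N1′) for the undressed composite response (`exists_respStep_decay_and_grad`), leaf-01 g57's `Psi_single_envelope` + `bmGaugeAt_respStep_envelope` for the potential. -/
theorem exists_dressed_slotLeg_envelopes (hLc : 2 ≤ Lc) :
    ∃ κ₀ C C' Cφ : ℝ, 0 < κ₀ ∧ 0 ≤ C ∧ 0 ≤ C' ∧ 0 ≤ Cφ ∧ ∀ (rr : Fin (3 + 1) → ℕ), rr ∈ box (3 + 1) Lc → ∀ (m k : ℕ),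
      (∀ (μ : Fin (3 + 1)) (y : Site (3 + 1)) (κ : Fin (3 + 1)) (v : Site (3 + 1)),
          |respStep (d := 3) (Lc ^ m) (Lc ^ (m + k + 1)) μ y κ v|
            ≤ C * ((Lc : ℝ) ^ (5 * (k + 1)))⁻¹ * Real.exp (-(κ₀ * supNorm (quo (Lc ^ (k + 1)) v - y)))) ∧
      (∀ (μ : Fin (3 + 1)) (y : Site (3 + 1)) (κ : Fin (3 + 1)) (v : Site (3 + 1)) (i : Fin (3 + 1)),
          |respStep (d := 3) (Lc ^ m) (Lc ^ (m + k + 1)) μ y κ (v + Pi.single i 1) - respStep (d := 3) (Lc ^ m) (Lc ^ (m + k + 1)) μ y κ v|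
            ≤ C' * ((Lc : ℝ) ^ (6 * (k + 1)))⁻¹ * Real.exp (-(κ₀ * supNorm (quo (Lc ^ (k + 1)) v - y)))) ∧
      (∀ (μ : Fin (3 + 1)) (y v : Site (3 + 1)),
          |Psi (toSite rr) Lc m k (fun μ' y' => if μ' = μ then (if y' = y then (1 : ℝ) else 0) else 0) v
              - bmGaugeAt (toSite rr) (legAct (respStep (d := 3) (Lc ^ m) (Lc ^ (m + k + 1)))
                  (fun μ' y' => if μ' = μ then (if y' = y then (1 : ℝ) else 0) else 0)) Lc v|
            ≤ Cφ * ((Lc : ℝ) ^ (4 * (k + 1)))⁻¹ * Real.exp (-(κ₀ * supNorm (quo (Lc ^ (k + 1)) v - y)))) := by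
  obtain ⟨κ₀, C, C', hκ₀, hC, hC', hN1', hN1g'⟩ := exists_respStep_decay_and_grad (Lc := Lc)
  have hN1 : ∀ (m k : ℕ) (μ : Fin (3 + 1)) (z : Site (3 + 1)) (l'' : Fin (3 + 1)) (w' : Site (3 + 1)),
      |respStep (d := 3) (Lc ^ m) (Lc ^ (m + k + 1)) μ z l'' w'| ≤
        C * ((Lc : ℝ) ^ (5 * (k + 1)))⁻¹ * Real.exp (-(κ₀ * supNorm (quo (Lc ^ (k + 1)) w' - z))) := by
    intro m k μ z l'' w'
    have h := hN1' m k μ z l'' w'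
    rwa [inv_cast_pow_pow] at h
  have hN1g : ∀ (m k : ℕ) (μ : Fin (3 + 1)) (z : Site (3 + 1)) (l'' : Fin (3 + 1)) (w' : Site (3 + 1)) (ν : Fin (3 + 1)),
      |respStep (d := 3) (Lc ^ m) (Lc ^ (m + k + 1)) μ z l'' (w' + Pi.single ν 1) - respStep (d := 3) (Lc ^ m) (Lc ^ (m + k + 1)) μ z l'' w'| ≤
        C' * ((Lc : ℝ) ^ (6 * (k + 1)))⁻¹ * Real.exp (-(κ₀ * supNorm (quo (Lc ^ (k + 1)) w' - z))) := by
    intro m k μ z l'' w' ν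
    have h := hN1g' m k μ z l'' w' ν
    rwa [inv_cast_pow_pow] at h
  have hLc1 : 1 ≤ Lc := le_trans (by norm_num) hLc
  have hL1 : (1 : ℝ) ≤ Lc := by exact_mod_cast hLc1
  refine ⟨κ₀, C, C', 16 * C + 8 * (Lc : ℝ) * C, hκ₀, hC, hC', by positivity, ?_⟩
  intro rr hrr m k
  refine ⟨fun μ y κ v => hN1 m k μ y κ v, fun μ y κ v i => hN1g m k μ y κ v i, fun μ y v => ?_⟩
  -- the potential: `|Ψ| + |bm gauge|`
  have hPsi := Psi_single_envelope (Lc := Lc) hLc hC hN1 hrr m k μ y v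
  have hg := bmGaugeAt_respStep_envelope (Lc := Lc) hN1 hrr m k (m + k + 1) rfl μ y v
  have hlab : blk (Lc ^ k) (blk Lc v) = quo (Lc ^ (k + 1)) v := by
    have h1 := blk_pow_blk_pow Lc k 1 v
    rw [pow_one, show 1 + k = k + 1 by ring] at h1
    rw [h1]; rfl
  rw [hlab] at hg
  have hpow : ((Lc : ℝ) ^ (5 * (k + 1)))⁻¹ ≤ ((Lc : ℝ) ^ (4 * (k + 1)))⁻¹ :=
    inv_anti₀ (by positivity) (pow_le_pow_right₀ hL1 (by omega))
  have hE0 : 0 ≤ Real.exp (-(κ₀ * supNorm (quo (Lc ^ (k + 1)) v - y))) := (Real.exp_pos _).le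
  have hg' : |bmGaugeAt (toSite rr) (legAct (respStep (d := 3) (Lc ^ m) (Lc ^ (m + k + 1)))
        (fun μ' y' => if μ' = μ then (if y' = y then (1 : ℝ) else 0) else 0)) Lc v|
      ≤ 8 * (Lc : ℝ) * C * ((Lc : ℝ) ^ (4 * (k + 1)))⁻¹ * Real.exp (-(κ₀ * supNorm (quo (Lc ^ (k + 1)) v - y))) := by
    refine hg.trans ?_
    have h8 : 0 ≤ 8 * (Lc : ℝ) * C := by positivity
    exact mul_le_mul_of_nonneg_right (mul_le_mul_of_nonneg_left hpow h8) hE0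
  calc _ ≤ |Psi (toSite rr) Lc m k (fun μ' y' => if μ' = μ then (if y' = y then (1 : ℝ) else 0) else 0) v|
        + |bmGaugeAt (toSite rr) (legAct (respStep (d := 3) (Lc ^ m) (Lc ^ (m + k + 1)))
            (fun μ' y' => if μ' = μ then (if y' = y then (1 : ℝ) else 0) else 0)) Lc v| := abs_sub _ _
    _ ≤ 16 * C * ((Lc : ℝ) ^ (4 * (k + 1)))⁻¹ * Real.exp (-(κ₀ * supNorm (quo (Lc ^ (k + 1)) v - y)))
        + 8 * (Lc : ℝ) * C * ((Lc : ℝ) ^ (4 * (k + 1)))⁻¹ * Real.exp (-(κ₀ * supNorm (quo (Lc ^ (k + 1)) v - y))) := add_le_add hPsi hg'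
    _ = _ := by ring

end Three

end Summit.QuantumFields.BalabanUV.Beta.GAN24.DressedSlotLegSplit

end
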